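import Literature.NumberTheory.DiophantineGeometry.BelyiDegreeFaltingsHeight
import Literature.NumberTheory.DiophantineGeometry.FunctionFieldPointCountRationalProofs
import HarnessLib

/-!
# Belyi functions and the Belyi degree are invariants of the function field

Transport of structure for the notions of `BelyiDegreeFaltingsHeight` along a `K`-isomorphism
`e : F ≃ₐ[K] F'` of function fields, using the transport of places `PlaceOver.mapAlgEquiv` of
`FunctionFieldPointCountRationalProofs`:

* `PlaceOver.ord_mapAlgEquiv`: `ord_{e(P)}(y) = ord_P(e⁻¹ y)` (Stichtenoth Lemma 3.5.2 for
  isomorphisms);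
* `IsBelyiFunction.map_algEquiv`, `isBelyiFunction_map_algEquiv_iff`: `f` is a Belyi function of
  `F/K` iff `e f` is one of `F'/K`;
* `finrank_adjoin_map_algEquiv`: `[F' : K(e f)] = [F : K(f)]`;
* **`belyiDegree_eq_of_algEquiv`**: `deg_B(F/K) = deg_B(F'/K)` — the Belyi degree of a curve
  ("the minimal degree of a finite morphism `X → ℙ¹` unramified over `ℙ¹ ∖ {0, 1, ∞}`",
  [cite: Javanpeykar2014, §1.1]) only depends on its isomorphism class, as is implicit throughout
  [cite: Javanpeykar2014] (e.g. in Thm. 1.1.1, where `deg_B(X)` is attached to the `ℚ̄`-isomorphism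
  class of the curve `X`).

## References

* A. Javanpeykar, *Polynomial bounds for Arakelov invariants of Belyi curves*, Algebra & Number
  Theory 8 (2014), §1.1. [Javanpeykar2014]
* H. Stichtenoth, *Algebraic Function Fields and Codes*, 2nd ed., GTM 254, Springer 2009,
  Lemma 3.5.2. [Stichtenoth2009]
-/

namespace Literature.NumberTheory.DiophantineGeometry.AlgFunctionField

open scoped IntermediateField

universe u v w

variable {K : Type u} {F : Type v} {F' : Type w} [Field K] [Field F] [Algebra K F] [Field F']
  [Algebra K F'] [IsAlgFunctionField K F] [IsAlgFunctionField K F']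

namespace PlaceOver

omit [IsAlgFunctionField K F] in
/-- `e⁻¹` maps a uniformizer of `e(P)` to a uniformizer of `P`. [folklore] -/
theorem ord_symm_uniformizer_mapAlgEquiv (e : F ≃ₐ[K] F') (P : PlaceOver K F) :
    P.ord (e.symm ((P.mapAlgEquiv e).uniformizer : F')) = 1 := by
  let eqv : (P.mapAlgEquiv e).toValuationSubring ≃* P.toValuationSubring :=
    { toFun := fun y ↦ ⟨e.symm (y : F'), y.2⟩
      invFun := fun y ↦ ⟨e (y : F), by
        change e.symm (e (y : F)) ∈ P.toValuationSubring
        rw [AlgEquiv.symm_apply_apply]; exact y.2⟩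
      left_inv := fun y ↦ Subtype.ext (e.apply_symm_apply (y : F'))
      right_inv := fun y ↦ Subtype.ext (e.symm_apply_apply (y : F))
      map_mul' := fun y z ↦ Subtype.ext (map_mul e.symm (y : F') z) }
  have hirr : Irreducible (eqv (P.mapAlgEquiv e).uniformizer) :=
    (MulEquiv.irreducible_iff eqv).2 (P.mapAlgEquiv e).irreducible_uniformizer
  have hmem : e.symm ((P.mapAlgEquiv e).uniformizer : F') ∈ P.toValuationSubring :=
    ((P.mapAlgEquiv e).uniformizer).2
  rw [P.ord_of_mem hmem]
  have : (⟨e.symm ((P.mapAlgEquiv e).uniformizer : F'), hmem⟩ : P.toValuationSubring) =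
      eqv (P.mapAlgEquiv e).uniformizer := rfl
  rw [this, IsDiscreteValuationRing.addVal_uniformizer hirr]
  rfl

omit [IsAlgFunctionField K F] in
/-- **`ord_{e(P)}(y) = ord_P(e⁻¹ y)`**: isomorphisms transport valuations (Stichtenoth Lemma 3.5.2,
stated there for automorphisms; same proof). [cite: Stichtenoth2009, Lemma 3.5.2] -/
theorem ord_mapAlgEquiv (e : F ≃ₐ[K] F') (P : PlaceOver K F) (y : F') :
    (P.mapAlgEquiv e).ord y = P.ord (e.symm y) := by
  rcases eq_or_ne y 0 with rfl | hy
  · rw [map_zero, PlaceOver.ord_zero, PlaceOver.ord_zero]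
  set P' := P.mapAlgEquiv e with hP'
  set σ : F' ≃ₐ[K] F := e.symm with hσ
  set m : ℤ := P'.ord y with hm
  set π' : F' := (P'.uniformizer : F') with hπ'
  have hπ'0 : π' ≠ 0 := P'.coe_uniformizer_ne_zero
  have hσπ0 : σ π' ≠ 0 := (_root_.map_ne_zero σ).2 hπ'0
  set u : F' := y * π' ^ (-m) with hu
  have hu0 : u ≠ 0 := mul_ne_zero hy (zpow_ne_zero _ hπ'0)
  have hπ'1 : P'.ord π' = 1 := by simpa using P'.ord_uniformizer_zpow 1
  have hordu : P'.ord u = 0 := by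
    rw [hu, P'.ord_mul_eq hy (zpow_ne_zero _ hπ'0), P'.ord_zpow hπ'0, hπ'1, ← hm]
    ring
  have huO : u ∈ P'.toValuationSubring := (P'.mem_toValuationSubring_iff_ord_nonneg hu0).2 hordu.ge
  have huiO : u⁻¹ ∈ P'.toValuationSubring :=
    (P'.mem_toValuationSubring_iff_ord_nonneg (inv_ne_zero hu0)).2 (by rw [P'.ord_inv hu0]; omega)
  have hσu : σ u ∈ P.toValuationSubring := huO
  have hσui : (σ u)⁻¹ ∈ P.toValuationSubring := by rw [← map_inv₀]; exact huiO
  have hσu0 : σ u ≠ 0 := (_root_.map_ne_zero σ).2 hu0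
  have hordσu : P.ord (σ u) = 0 := by
    have h1 := P.ord_nonneg_of_mem hσu
    have h2 := P.ord_nonneg_of_mem hσui
    rw [P.ord_inv hσu0] at h2
    omega
  have hy' : σ y = σ u * σ π' ^ m := by
    rw [hu, map_mul, map_zpow₀, mul_assoc, ← zpow_add₀ hσπ0, neg_add_cancel, zpow_zero, mul_one]
  rw [hy', P.ord_mul_eq hσu0 (zpow_ne_zero _ hσπ0), hordσu, P.ord_zpow hσπ0, hσ,
    ord_symm_uniformizer_mapAlgEquiv, zero_add, mul_one]

omit [IsAlgFunctionField K F'] in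
/-- `ord_{e⁻¹(P')}(x) = ord_{P'}(e x)`. [cite: Stichtenoth2009, Lemma 3.5.2] -/
theorem ord_mapAlgEquiv_symm (e : F ≃ₐ[K] F') (P' : PlaceOver K F') (x : F) :
    (P'.mapAlgEquiv e.symm).ord x = P'.ord (e x) := by
  rw [ord_mapAlgEquiv]; rfl

end PlaceOver

/-! ### Belyi functions -/

omit [IsAlgFunctionField K F'] in
/-- **Belyi functions are transported by `K`-isomorphisms**: `f` Belyi for `F/K` ⇒ `e f` Belyi for
`F'/K`. [cite: Javanpeykar2014, §1.1] -/
theorem IsBelyiFunction.map_algEquiv (e : F ≃ₐ[K] F') {f : F} (h : IsBelyiFunction K f) :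
    IsBelyiFunction K (e f) := by
  refine ⟨?_, fun c hc0 hc1 P' hP' ↦ ?_⟩
  · rintro ⟨c, hc⟩
    exact h.1 ⟨c, by rw [← e.symm.commutes c, hc, AlgEquiv.symm_apply_apply]⟩
  · have key : e f - algebraMap K F' c = e (f - algebraMap K F c) := by
      rw [map_sub, AlgEquiv.commutes]
    rw [key, ← PlaceOver.ord_mapAlgEquiv_symm] at hP' ⊢
    exact h.2 c hc0 hc1 _ hP'

/-- `f` is a Belyi function of `F/K` iff `e f` is one of `F'/K`. [cite: Javanpeykar2014, §1.1] -/
theorem isBelyiFunction_map_algEquiv_iff (e : F ≃ₐ[K] F') (f : F) :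
    IsBelyiFunction K (e f) ↔ IsBelyiFunction K f :=
  ⟨fun h ↦ by simpa using h.map_algEquiv e.symm, fun h ↦ h.map_algEquiv e⟩

omit [IsAlgFunctionField K F] [IsAlgFunctionField K F'] in
/-- **Degrees are transported**: `[F' : K(e f)] = [F : K(f)]`, `e` restricting to an isomorphism
`K(f) ≃ K(e f)`. [folklore] -/
theorem finrank_adjoin_map_algEquiv (e : F ≃ₐ[K] F') (f : F) :
    Module.finrank K⟮e f⟯ F' = Module.finrank K⟮f⟯ F := by
  have hmap : K⟮f⟯.map (e : F →ₐ[K] F') = K⟮e f⟯ := by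
    rw [IntermediateField.adjoin_map, Set.image_singleton]; rfl
  let i : K⟮f⟯ ≃ₐ[K] K⟮e f⟯ :=
    (K⟮f⟯.equivMap (e : F →ₐ[K] F')).trans (IntermediateField.equivOfEq hmap)
  symm
  refine Algebra.finrank_eq_of_equiv_equiv i.toRingEquiv e.toRingEquiv ?_
  ext x
  rfl

/-- **The Belyi degree is an invariant of the function field**: `deg_B(F/K) = deg_B(F'/K)` for
`K`-isomorphic function fields — the Belyi degree of a curve only depends on its isomorphism class
[cite: Javanpeykar2014, §1.1]. -/
theorem belyiDegree_eq_of_algEquiv (e : F ≃ₐ[K] F') : belyiDegree K F = belyiDegree K F' := by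
  unfold belyiDegree
  congr 1
  ext n
  constructor
  · rintro ⟨f, hf, rfl⟩
    exact ⟨e f, hf.map_algEquiv e, finrank_adjoin_map_algEquiv e f⟩
  · rintro ⟨f', hf', rfl⟩
    exact ⟨e.symm f', hf'.map_algEquiv e.symm, finrank_adjoin_map_algEquiv e.symm f'⟩

/-- Existence of Belyi functions is transported. [cite: Javanpeykar2014, §1.1] -/
theorem exists_isBelyiFunction_iff_of_algEquiv (e : F ≃ₐ[K] F') :
    (∃ f' : F', IsBelyiFunction K f') ↔ ∃ f : F, IsBelyiFunction K f :=
  ⟨fun ⟨f', hf'⟩ ↦ ⟨e.symm f', hf'.map_algEquiv e.symm⟩, fun ⟨f, hf⟩ ↦ ⟨e f, hf.map_algEquiv e⟩⟩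

end Literature.NumberTheory.DiophantineGeometry.AlgFunctionField
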